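import Literature.AlgebraicGeometry.HodgeTheory.FermatHodgeCharactersPrimePow
import HarnessLib

/-!
# Koblitz–Ogus relations for the Hodge multisets of level `18p` (Shioda 1982 §3 / Aoki 1983 Prop. 2.2, via Deligne LNM 900 Rem. 7.16 (a))

Topic `Literature/AlgebraicGeometry/Shioda1982`. THEOREMS (no named fact, no `sorry`): the first step towards the levels `m = 18p`
of the series `PicardNumber*.lean` / `HodgeQuadruples*Prime.lean` (indecomposable Hodge quadruples and the Picard number of the
Fermat surface `X²ₘ`, T. Shioda, *On the Picard number of a Fermat surface*, J. Fac. Sci. Univ. Tokyo IA **28** (1982) 725–734):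
two explicit, `p`-independent families of LINEAR RELATIONS satisfied by the multiplicity function of every Hodge multiset
(`FermatCharacter.IsHodgeMultiset`, Shioda's condition `Σ⟨t aᵢ⟩` constant) of level `18p`, `p ≥ 5` prime, in the Chinese-remainder
coordinates `ℤ/18p ≅ ℤ/18 × ℤ/p`, `w ↔ (u, c)` (**`crtPt`**). Writing `ô(u, c) = #_{(u,c)}(s) − #_{(−u,−c)}(s)` (**`oddCount`**), for
every `c ≢ 0 (mod p)`:

* **`relOne_eighteenPrime`**: `−ô(5,c) + ô(7,c) + ô(11,c) − ô(13,c) + ô(1,2c) + ô(4,2c) − ô(5,2c) − ô(8,2c) − ô(10,2c) − ô(13,2c) + ô(14,2c) + ô(17,2c) = 0`;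
* **`relTwo_eighteenPrime`**: `ô(1,c) − ô(5,c) − ô(13,c) + ô(17,c) + ô(1,2c) + ô(2,2c) − ô(7,2c) − ô(8,2c) − ô(10,2c) − ô(11,2c) + ô(16,2c) + ô(17,2c) = 0`.

PROOF (this formalisation's; the printed route is Shioda's inductive structure / Aoki's Prop. 2.2): by the tree's PROVED
`KoblitzOgus.hodge_eq_combination` [Deligne1982HodgeCycles, Rem. 7.16 (a)] the multiplicity function of a Hodge multiset of level `N`
is a `ℚ`-combination of reflection vectors `e_a + e_{−a}` and distribution vectors `D_{M,z} = 𝟙[· ≡ z (M)] − 𝟙[· = (N/M) z]`, `M ∣ N`;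
the two functionals are odd and annihilate every `D_{M,z}`, `M ∣ 18p` — checked divisor class by divisor class
(`M = k`, `k·p` for `k ∣ 18`) in coordinates, where each check is a finite computation in `ℤ/18` (`relOne_koD`, `relTwo_koD`).
WHY THESE: the space of odd functionals on `ℚ^{ℤ/18p}` annihilating all `D_{M,z}` has dimension `3(p − 1)` (one per odd character of
`(ℤ/18p)ˣ`), and — unlike the levels `4p, 8p, 12p` (`o(y + m/2) = o(y)`) — NONE of them is supported on odd residues only; the two
families here (supported on the residues prime to `3` of the fibres `±c, ±2c`) span the `2(p − 2)`-dimensional part supported on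
residues prime to `3` off the fibre `pℤ/18p` (cell `pub-hfermat`, `code/lit/picard/scope_relations.py`, `rel18p_*.py`: found by exact
linear algebra at `p = 11, 13, 17`, verified against every `D_{M,z}` at `p = 5, …, 23`). They are the input for the classification of
the indecomposable Hodge quadruples of level `18p` (Shioda's Prop. 4 (Q′) with `m′ = 9p`, `m″ = 6p`, plus the lifted exceptional
quadruples of level `18`), not carried out in this file.

HONEST FRAMING (cell `pub-hfermat`): explicit algebraic cycles for specific Hodge classes on Fermat/Delsarte varieties; residual open
instances listed; no claim on general Hodge. (Surface classes are algebraic by Lefschetz (1,1); this file proves linear identities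
that follow from a printed theorem.)

## References
* [Deligne1982HodgeCycles] P. Deligne, *Hodge cycles on abelian varieties*, LNM 900 (1982), Rem. 7.16 (a) (Koblitz–Ogus), through the
  tree's `Literature.NumberTheory.Transcendental.KoblitzOgus.hodge_eq_combination`.
* [Aoki1983] N. Aoki, *On some arithmetic problems related to the Hodge cycles on the Fermat varieties*, Math. Ann. 266 (1983) 23–54,
  Prop. 2.2 (relations among Hodge cycles under level change).
* [Shioda1982PicardFermat] T. Shioda, J. Fac. Sci. Univ. Tokyo IA 28 (1982) 725–734, §3 p. 727 (the method), Prop. 4 (Q′) p. 729.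
* [Shioda1979PJA] T. Shioda, Proc. Japan Acad. 55A (1979), §1 (2) (the Hodge condition).
-/

namespace Literature.AlgebraicGeometry.Shioda1982

open Finset Multiset Literature.AlgebraicGeometry.HodgeTheory Literature.AlgebraicGeometry.HodgeTheory.FermatCharacter

section EighteenPrime

variable {p : ℕ}

/-! ### `ℤ/18p ≅ ℤ/18 × ℤ/p`: Chinese-remainder coordinates -/

/-- The Chinese-remainder isomorphism `ℤ/18p ≃+* ℤ/18 × ℤ/p`. [folklore] -/
private def crt (h : Nat.Coprime 18 p) : ZMod (18 * p) ≃+* ZMod 18 × ZMod p := ZMod.chineseRemainder h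

/-- The residue with coordinates `(e, b)`. [folklore] -/
private def pt (h : Nat.Coprime 18 p) (e : ZMod 18) (b : ZMod p) : ZMod (18 * p) := (crt h).symm (e, b)

/-- First coordinate = residue mod `18`. [folklore] -/
private theorem crt_fst (h : Nat.Coprime 18 p) [NeZero (18 * p)] (w : ZMod (18 * p)) :
    (crt h w).1 = (w.val : ZMod 18) := by
  conv_lhs => rw [← ZMod.natCast_zmod_val w]
  rw [map_natCast, Prod.fst_natCast]

/-- Second coordinate = residue mod `p`. [folklore] -/
private theorem crt_snd (h : Nat.Coprime 18 p) [NeZero (18 * p)] (w : ZMod (18 * p)) :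
    (crt h w).2 = (w.val : ZMod p) := by
  conv_lhs => rw [← ZMod.natCast_zmod_val w]
  rw [map_natCast, Prod.snd_natCast]

/-- `crt (pt e b) = (e, b)`. [folklore] -/
private theorem crt_pt (h : Nat.Coprime 18 p) (e : ZMod 18) (b : ZMod p) : crt h (pt h e b) = (e, b) :=
  (crt h).apply_symm_apply (e, b)

/-- `pt (crt w) = w`. [folklore] -/
private theorem pt_crt (h : Nat.Coprime 18 p) (w : ZMod (18 * p)) : pt h (crt h w).1 (crt h w).2 = w :=
  (crt h).symm_apply_apply w

/-- `pt` is injective. [folklore] -/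
private theorem pt_inj (h : Nat.Coprime 18 p) {e e' : ZMod 18} {b b' : ZMod p} :
    pt h e b = pt h e' b' ↔ e = e' ∧ b = b' := by
  rw [pt, pt, (crt h).symm.injective.eq_iff, Prod.mk.injEq]

/-- `pt` and negation. [folklore] -/
private theorem neg_pt (h : Nat.Coprime 18 p) (e : ZMod 18) (b : ZMod p) : -pt h e b = pt h (-e) (-b) := by
  rw [pt, pt, ← (crt h).symm.map_neg, Prod.neg_mk]

/-- `pt` and natural multiples. [folklore] -/
private theorem natCast_mul_pt (h : Nat.Coprime 18 p) (k : ℕ) (e : ZMod 18) (b : ZMod p) :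
    (k : ZMod (18 * p)) * pt h e b = pt h (k * e) (k * b) := by
  rw [pt, pt, ← nsmul_eq_mul, ← _root_.map_nsmul, Prod.smul_mk, nsmul_eq_mul, nsmul_eq_mul]

/-! ### The Koblitz–Ogus distribution vectors in Chinese-remainder coordinates -/

/-- The Koblitz–Ogus distribution vector of level `M ∣ 18p` through `z` (as in `KoblitzOgus.hodge_eq_combination`):
`w ↦ [w ≡ z (mod M)] − [(18p/M)·z = w]`. [cite: Deligne1982HodgeCycles, Rem. 7.16 (a)] -/
private def koD (N : ℕ) (M : ℕ) (z w : ZMod N) : ℚ :=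
  (if w.val % M = z.val % M then (1 : ℚ) else 0) - (if ((N / M : ℕ) : ZMod N) * z = w then 1 else 0)

/-- The divisors of `18p`. [folklore] -/
private theorem eq_of_dvd_eighteen_mul_prime (hp : p.Prime) (h5 : 5 ≤ p) {M : ℕ} (hM : M ∣ 18 * p) :
    M = 1 ∨ M = 2 ∨ M = 3 ∨ M = 6 ∨ M = 9 ∨ M = 18 ∨
      M = p ∨ M = 2 * p ∨ M = 3 * p ∨ M = 6 * p ∨ M = 9 * p ∨ M = 18 * p := by
  obtain ⟨a, b, ha, hb, rfl⟩ := (Nat.dvd_mul.1 hM)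
  have ha' : a = 1 ∨ a = 2 ∨ a = 3 ∨ a = 6 ∨ a = 9 ∨ a = 18 := by
    have := Nat.le_of_dvd (by norm_num) ha
    interval_cases a <;> simp_all
  rcases (Nat.dvd_prime hp).1 hb with rfl | rfl <;> rcases ha' with rfl | rfl | rfl | rfl | rfl | rfl <;> simp

/-- Congruence mod `p` in coordinates. [folklore] -/
private theorem mod_p_iff (h : Nat.Coprime 18 p) [NeZero (18 * p)] (w z : ZMod (18 * p)) :
    w.val % p = z.val % p ↔ (crt h w).2 = (crt h z).2 := by
  rw [crt_snd, crt_snd, ZMod.natCast_eq_natCast_iff']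

/-- Congruence mod a divisor `k` of `18` in coordinates. [folklore] -/
private theorem mod_dvd_eighteen_iff (h : Nat.Coprime 18 p) [NeZero (18 * p)] {k : ℕ} (hk : k ∣ 18)
    (w z : ZMod (18 * p)) : w.val % k = z.val % k ↔ (crt h w).1.val % k = (crt h z).1.val % k := by
  rw [crt_fst, crt_fst, ZMod.val_natCast, ZMod.val_natCast, Nat.mod_mod_of_dvd _ hk, Nat.mod_mod_of_dvd _ hk]

/-- Congruence mod `k·p`, `k ∣ 18`, in coordinates. [folklore] -/
private theorem mod_dvd_eighteen_mul_iff (h : Nat.Coprime 18 p) [NeZero (18 * p)] {k : ℕ} (hk : k ∣ 18)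
    (w z : ZMod (18 * p)) :
    w.val % (k * p) = z.val % (k * p) ↔ (crt h w).1.val % k = (crt h z).1.val % k ∧ (crt h w).2 = (crt h z).2 := by
  have hkp : Nat.Coprime k p := Nat.Coprime.coprime_dvd_left hk h
  rw [← mod_dvd_eighteen_iff h hk, ← mod_p_iff]
  exact (Nat.modEq_and_modEq_iff_modEq_mul hkp).symm

/-- A multiple of `z = pt e b` in coordinates. [folklore] -/
private theorem natCast_mul_eq_pt_iff (h : Nat.Coprime 18 p) (k : ℕ) (ez e : ZMod 18) (bz c : ZMod p) :
    (k : ZMod (18 * p)) * pt h ez bz = pt h e c ↔ (k : ZMod 18) * ez = e ∧ (k : ZMod p) * bz = c := by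
  rw [natCast_mul_pt, pt_inj]

/-- Cancellation by `2` in `ℤ/p`, `p` odd prime, in the orientations used below. [folklore] -/
private theorem cancel_two (hp : p.Prime) (h5 : 5 ≤ p) (c x : ZMod p) :
    (2 * x = 2 * c ↔ c = x) ∧ (2 * x = -(2 * c) ↔ -c = x) := by
  haveI := Fact.mk hp
  have h2 : (2 : ZMod p) ≠ 0 := by
    intro h0
    have := (ZMod.natCast_eq_zero_iff 2 p).1 (by exact_mod_cast h0)
    exact absurd (Nat.le_of_dvd (by norm_num) this) (by omega)
  have key : ∀ u : ZMod p, (2 * x = 2 * u ↔ u = x) := fun u ↦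
    ⟨fun e ↦ (mul_left_cancel₀ h2 e).symm, fun e ↦ by rw [e]⟩
  refine ⟨key c, ?_⟩
  rw [show -(2 * c) = 2 * (-c) by ring]; exact key _

/-- `k b ≠ 0` for `b ≠ 0` and `1 ≤ k < p`. [folklore] -/
private theorem natCast_mul_ne_zero' (hp : p.Prime) {b : ZMod p} (hb : b ≠ 0) {k : ℕ} (hk0 : 0 < k)
    (hk : k < p) : (k : ZMod p) * b ≠ 0 := by
  haveI := Fact.mk hp
  intro h
  rcases mul_eq_zero.1 h with h2 | h2
  · rw [ZMod.natCast_eq_zero_iff] at h2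
    have := Nat.le_of_dvd hk0 h2
    omega
  · exact hb h2

/-- `2c ≠ 0` for `c ≠ 0` in `ℤ/p`, `p` odd. [folklore] -/
private theorem two_mul_ne_zero' (hp : p.Prime) (h5 : 5 ≤ p) {c : ZMod p} (hc : c ≠ 0) : 2 * c ≠ 0 := by
  exact_mod_cast natCast_mul_ne_zero' hp hc (k := 2) (by norm_num) (by omega)

/-! ### The two functionals of level `18p` -/

/-- `ĝ(w) = g(w) − g(−w)`: twice the odd part. [folklore] -/
private def hat (g : ZMod (18 * p) → ℚ) (w : ZMod (18 * p)) : ℚ := g w - g (-w)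

/-- **The first functional** `R¹(c)`: `−ĝ(5,c) + ĝ(7,c) + ĝ(11,c) − ĝ(13,c) + ĝ(1,2c) + ĝ(4,2c) − ĝ(5,2c) − ĝ(8,2c) − ĝ(10,2c)
− ĝ(13,2c) + ĝ(14,2c) + ĝ(17,2c)`. [folklore] -/
private def R1 (h : Nat.Coprime 18 p) (g : ZMod (18 * p) → ℚ) (c : ZMod p) : ℚ :=
  -hat g (pt h 5 c) + hat g (pt h 7 c) + hat g (pt h 11 c) - hat g (pt h 13 c) +
    hat g (pt h 1 (2 * c)) + hat g (pt h 4 (2 * c)) - hat g (pt h 5 (2 * c)) - hat g (pt h 8 (2 * c)) -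
    hat g (pt h 10 (2 * c)) - hat g (pt h 13 (2 * c)) + hat g (pt h 14 (2 * c)) + hat g (pt h 17 (2 * c))

/-- **The second functional** `R²(c)`: `ĝ(1,c) − ĝ(5,c) − ĝ(13,c) + ĝ(17,c) + ĝ(1,2c) + ĝ(2,2c) − ĝ(7,2c) − ĝ(8,2c) − ĝ(10,2c)
− ĝ(11,2c) + ĝ(16,2c) + ĝ(17,2c)`. [folklore] -/
private def R2 (h : Nat.Coprime 18 p) (g : ZMod (18 * p) → ℚ) (c : ZMod p) : ℚ :=
  hat g (pt h 1 c) - hat g (pt h 5 c) - hat g (pt h 13 c) + hat g (pt h 17 c) +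
    hat g (pt h 1 (2 * c)) + hat g (pt h 2 (2 * c)) - hat g (pt h 7 (2 * c)) - hat g (pt h 8 (2 * c)) -
    hat g (pt h 10 (2 * c)) - hat g (pt h 11 (2 * c)) + hat g (pt h 16 (2 * c)) + hat g (pt h 17 (2 * c))

/-- `ĝ` is additive. [folklore] -/
private theorem hat_add (g g' : ZMod (18 * p) → ℚ) (w : ZMod (18 * p)) :
    hat (fun z ↦ g z + g' z) w = hat g w + hat g' w := by
  simp only [hat]; ring

/-- `ĝ` is homogeneous. [folklore] -/
private theorem hat_smul (a : ℚ) (g : ZMod (18 * p) → ℚ) (w : ZMod (18 * p)) :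
    hat (fun z ↦ a * g z) w = a * hat g w := by
  simp only [hat]; ring

/-- `ĝ` commutes with sums. [folklore] -/
private theorem hat_sum {ι : Type} (t : Finset ι) (g : ι → ZMod (18 * p) → ℚ) (w : ZMod (18 * p)) :
    hat (fun z ↦ ∑ i ∈ t, g i z) w = ∑ i ∈ t, hat (g i) w := by
  simp only [hat, Finset.sum_sub_distrib]

/-- `ĝ = 0` for negation-invariant `g`. [folklore] -/
private theorem hat_even {g : ZMod (18 * p) → ℚ} (hg : ∀ z, g (-z) = g z) (w : ZMod (18 * p)) : hat g w = 0 := by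
  simp only [hat, hg, sub_self]

/-- `R¹` is linear and kills negation-invariant functions. [folklore] -/
private theorem R1_linear (h : Nat.Coprime 18 p) (c : ZMod p) :
    (∀ g g' : ZMod (18 * p) → ℚ, R1 h (fun z ↦ g z + g' z) c = R1 h g c + R1 h g' c) ∧
    (∀ (a : ℚ) (g : ZMod (18 * p) → ℚ), R1 h (fun z ↦ a * g z) c = a * R1 h g c) ∧
    (∀ {ι : Type} (t : Finset ι) (g : ι → ZMod (18 * p) → ℚ), R1 h (fun z ↦ ∑ i ∈ t, g i z) c = ∑ i ∈ t, R1 h (g i) c) ∧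
    (∀ g : ZMod (18 * p) → ℚ, (∀ z, g (-z) = g z) → R1 h g c = 0) := by
  refine ⟨fun g g' ↦ ?_, fun a g ↦ ?_, fun t g ↦ ?_, fun g hg ↦ ?_⟩
  · simp only [R1, hat_add]; ring
  · simp only [R1, hat_smul]; ring
  · simp only [R1, hat_sum, ← Finset.sum_add_distrib, ← Finset.sum_sub_distrib, ← Finset.sum_neg_distrib]
  · simp only [R1, hat_even hg]; ring

/-- `R²` is linear and kills negation-invariant functions. [folklore] -/
private theorem R2_linear (h : Nat.Coprime 18 p) (c : ZMod p) :
    (∀ g g' : ZMod (18 * p) → ℚ, R2 h (fun z ↦ g z + g' z) c = R2 h g c + R2 h g' c) ∧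
    (∀ (a : ℚ) (g : ZMod (18 * p) → ℚ), R2 h (fun z ↦ a * g z) c = a * R2 h g c) ∧
    (∀ {ι : Type} (t : Finset ι) (g : ι → ZMod (18 * p) → ℚ), R2 h (fun z ↦ ∑ i ∈ t, g i z) c = ∑ i ∈ t, R2 h (g i) c) ∧
    (∀ g : ZMod (18 * p) → ℚ, (∀ z, g (-z) = g z) → R2 h g c = 0) := by
  refine ⟨fun g g' ↦ ?_, fun a g ↦ ?_, fun t g ↦ ?_, fun g hg ↦ ?_⟩
  · simp only [R2, hat_add]; ring
  · simp only [R2, hat_smul]; ring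
  · simp only [R2, hat_sum, ← Finset.sum_add_distrib, ← Finset.sum_sub_distrib]
  · simp only [R2, hat_even hg]; ring

/-! ### The functionals kill every distribution vector -/

/-- A point with non-zero second coordinate is not of the form `pt e 0`. [folklore] -/
private theorem pt_ne_pt_zero (h : Nat.Coprime 18 p) {c : ZMod p} (hc : c ≠ 0) (e e' : ZMod 18) :
    pt h e' 0 ≠ pt h e c := fun eq ↦ hc ((pt_inj h).1 eq).2.symm

/-- `ĝ` of a distribution vector at a coordinate point, unfolded. [folklore] -/
private theorem hat_koD (h : Nat.Coprime 18 p) (M : ℕ) (z : ZMod (18 * p)) (e : ZMod 18) (c : ZMod p) :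
    hat (koD (18 * p) M z) (pt h e c) =
      ((if (pt h e c).val % M = z.val % M then (1 : ℚ) else 0) -
        (if (pt h (-e) (-c)).val % M = z.val % M then (1 : ℚ) else 0)) -
      ((if ((18 * p / M : ℕ) : ZMod (18 * p)) * z = pt h e c then (1 : ℚ) else 0) -
        (if ((18 * p / M : ℕ) : ZMod (18 * p)) * z = pt h (-e) (-c) then (1 : ℚ) else 0)) := by
  simp only [hat, koD, neg_pt]
  ring

/-- The distribution vector of level `18p` is zero. [folklore] -/
private theorem koD_top [NeZero (18 * p)] (z w : ZMod (18 * p)) : koD (18 * p) (18 * p) z w = 0 := by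
  have h0 : (18 * p) ≠ 0 := NeZero.ne _
  simp only [koD, Nat.mod_eq_of_lt (ZMod.val_lt _), Nat.div_self (Nat.pos_of_ne_zero h0), Nat.cast_one, one_mul]
  by_cases hw : w = z
  · rw [if_pos (by rw [hw]), if_pos hw.symm, sub_self]
  · rw [if_neg (fun e ↦ hw (ZMod.val_injective _ e)), if_neg (fun e ↦ hw e.symm), sub_self]

/-- Level `k ∣ 18`: `ĝ(e, c) = [e ≡ e_z (k)] − [−e ≡ e_z (k)]` off the fibre `0`. [folklore] -/
private theorem hat_koD_dvd_eighteen (h : Nat.Coprime 18 p) [NeZero (18 * p)] {k : ℕ} (hk : k ∣ 18) (hk0 : 0 < k)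
    (ez e : ZMod 18) {bz c : ZMod p} (hc : c ≠ 0) : hat (koD (18 * p) k (pt h ez bz)) (pt h e c) =
      (if e.val % k = ez.val % k then (1 : ℚ) else 0) - (if (-e).val % k = ez.val % k then (1 : ℚ) else 0) := by
  rw [hat_koD]
  obtain ⟨j, hj⟩ := hk
  have hjk : (18 * p / k : ℕ) = j * p := by
    rw [hj, mul_assoc]; exact Nat.mul_div_cancel_left _ hk0
  have hP : ((j * p : ℕ) : ZMod p) = 0 := by rw [Nat.cast_mul, ZMod.natCast_self, mul_zero]
  have n1 : ((j * p : ℕ) : ZMod (18 * p)) * pt h ez bz ≠ pt h e c := by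
    rw [natCast_mul_pt, hP, zero_mul]; exact pt_ne_pt_zero h hc _ _
  have n2 : ((j * p : ℕ) : ZMod (18 * p)) * pt h ez bz ≠ pt h (-e) (-c) := by
    rw [natCast_mul_pt, hP, zero_mul]; exact pt_ne_pt_zero h (neg_ne_zero.2 hc) _ _
  rw [hjk, if_neg n1, if_neg n2]
  simp only [mod_dvd_eighteen_iff h ⟨j, hj⟩, crt_pt, sub_zero]

/-- Level `p`: `ĝ(e, c) = [c = b_z] − [−c = b_z] − [0 = e, 18b_z = c] + [0 = −e, 18b_z = −c]`. [folklore] -/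
private theorem hat_koD_P (h : Nat.Coprime 18 p) [NeZero (18 * p)] (hp : p.Prime) (ez e : ZMod 18) (bz c : ZMod p) :
    hat (koD (18 * p) p (pt h ez bz)) (pt h e c) =
      ((if c = bz then (1 : ℚ) else 0) - (if -c = bz then (1 : ℚ) else 0)) -
      ((if 0 = e ∧ 18 * bz = c then (1 : ℚ) else 0) - (if 0 = -e ∧ 18 * bz = -c then (1 : ℚ) else 0)) := by
  rw [hat_koD]
  have h12 : (18 * p / p : ℕ) = 18 := Nat.mul_div_cancel 18 hp.pos
  have h120 : (18 : ZMod 18) * ez = 0 := by rw [show (18 : ZMod 18) = 0 by decide, zero_mul]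
  rw [h12]
  simp only [natCast_mul_eq_pt_iff]
  simp only [mod_p_iff h, crt_pt, Nat.cast_ofNat, h120]

/-- Level `k·p`, `k ∣ 18`, `18 = j·k`: `ĝ(e, c) = [e ≡ e_z (k), c = b_z] − [−e ≡ e_z (k), −c = b_z] − [j e_z = e, j b_z = c]
 + [j e_z = −e, j b_z = −c]`. [folklore] -/
private theorem hat_koD_mulP (h : Nat.Coprime 18 p) [NeZero (18 * p)] (hp : p.Prime) {k j : ℕ} (hjk : 18 = j * k)
    (ez e : ZMod 18) (bz c : ZMod p) :
    hat (koD (18 * p) (k * p) (pt h ez bz)) (pt h e c) =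
      ((if e.val % k = ez.val % k ∧ c = bz then (1 : ℚ) else 0) -
        (if (-e).val % k = ez.val % k ∧ -c = bz then (1 : ℚ) else 0)) -
      ((if (j : ZMod 18) * ez = e ∧ (j : ZMod p) * bz = c then (1 : ℚ) else 0) -
        (if (j : ZMod 18) * ez = -e ∧ (j : ZMod p) * bz = -c then (1 : ℚ) else 0)) := by
  rw [hat_koD]
  have hk0 : 0 < k := Nat.pos_of_ne_zero fun h0 ↦ by rw [h0, mul_zero] at hjk; exact absurd hjk (by norm_num)
  have hj : (18 * p / (k * p) : ℕ) = j := by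
    rw [hjk, show j * k * p = j * (k * p) by ring]; exact Nat.mul_div_cancel j (Nat.mul_pos hk0 hp.pos)
  rw [hj]
  simp only [natCast_mul_eq_pt_iff]
  simp only [mod_dvd_eighteen_mul_iff h ⟨j, by rw [hjk, mul_comm]⟩, crt_pt]

/-- `R¹` kills `D_{1,z}`. [folklore] -/
private theorem R1_koD_1 (h : Nat.Coprime 18 p) [NeZero (18 * p)] (hp : p.Prime) (h5 : 5 ≤ p)
    (ez : ZMod 18) (bz : ZMod p) {c : ZMod p} (hc : c ≠ 0) : R1 h (koD (18 * p) 1 (pt h ez bz)) c = 0 := by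
  have hc2 := two_mul_ne_zero' hp h5 hc
  simp only [R1, hat_koD_dvd_eighteen h (by norm_num : 1 ∣ 18) (by norm_num) _ _ hc,
    hat_koD_dvd_eighteen h (by norm_num : 1 ∣ 18) (by norm_num) _ _ hc2]
  fin_cases ez <;> simp +decide

/-- `R¹` kills `D_{2,z}`. [folklore] -/
private theorem R1_koD_2 (h : Nat.Coprime 18 p) [NeZero (18 * p)] (hp : p.Prime) (h5 : 5 ≤ p)
    (ez : ZMod 18) (bz : ZMod p) {c : ZMod p} (hc : c ≠ 0) : R1 h (koD (18 * p) 2 (pt h ez bz)) c = 0 := by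
  have hc2 := two_mul_ne_zero' hp h5 hc
  simp only [R1, hat_koD_dvd_eighteen h (by norm_num : 2 ∣ 18) (by norm_num) _ _ hc,
    hat_koD_dvd_eighteen h (by norm_num : 2 ∣ 18) (by norm_num) _ _ hc2]
  fin_cases ez <;> simp +decide

/-- `R¹` kills `D_{3,z}`. [folklore] -/
private theorem R1_koD_3 (h : Nat.Coprime 18 p) [NeZero (18 * p)] (hp : p.Prime) (h5 : 5 ≤ p)
    (ez : ZMod 18) (bz : ZMod p) {c : ZMod p} (hc : c ≠ 0) : R1 h (koD (18 * p) 3 (pt h ez bz)) c = 0 := by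
  have hc2 := two_mul_ne_zero' hp h5 hc
  simp only [R1, hat_koD_dvd_eighteen h (by norm_num : 3 ∣ 18) (by norm_num) _ _ hc,
    hat_koD_dvd_eighteen h (by norm_num : 3 ∣ 18) (by norm_num) _ _ hc2]
  fin_cases ez <;> simp +decide

/-- `R¹` kills `D_{6,z}`. [folklore] -/
private theorem R1_koD_6 (h : Nat.Coprime 18 p) [NeZero (18 * p)] (hp : p.Prime) (h5 : 5 ≤ p)
    (ez : ZMod 18) (bz : ZMod p) {c : ZMod p} (hc : c ≠ 0) : R1 h (koD (18 * p) 6 (pt h ez bz)) c = 0 := by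
  have hc2 := two_mul_ne_zero' hp h5 hc
  simp only [R1, hat_koD_dvd_eighteen h (by norm_num : 6 ∣ 18) (by norm_num) _ _ hc,
    hat_koD_dvd_eighteen h (by norm_num : 6 ∣ 18) (by norm_num) _ _ hc2]
  fin_cases ez <;> simp +decide

/-- `R¹` kills `D_{9,z}`. [folklore] -/
private theorem R1_koD_9 (h : Nat.Coprime 18 p) [NeZero (18 * p)] (hp : p.Prime) (h5 : 5 ≤ p)
    (ez : ZMod 18) (bz : ZMod p) {c : ZMod p} (hc : c ≠ 0) : R1 h (koD (18 * p) 9 (pt h ez bz)) c = 0 := by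
  have hc2 := two_mul_ne_zero' hp h5 hc
  simp only [R1, hat_koD_dvd_eighteen h (by norm_num : 9 ∣ 18) (by norm_num) _ _ hc,
    hat_koD_dvd_eighteen h (by norm_num : 9 ∣ 18) (by norm_num) _ _ hc2]
  fin_cases ez <;> simp +decide

/-- `R¹` kills `D_{18,z}`. [folklore] -/
private theorem R1_koD_18 (h : Nat.Coprime 18 p) [NeZero (18 * p)] (hp : p.Prime) (h5 : 5 ≤ p)
    (ez : ZMod 18) (bz : ZMod p) {c : ZMod p} (hc : c ≠ 0) : R1 h (koD (18 * p) 18 (pt h ez bz)) c = 0 := by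
  have hc2 := two_mul_ne_zero' hp h5 hc
  simp only [R1, hat_koD_dvd_eighteen h (by norm_num : 18 ∣ 18) (by norm_num) _ _ hc,
    hat_koD_dvd_eighteen h (by norm_num : 18 ∣ 18) (by norm_num) _ _ hc2]
  fin_cases ez <;> simp +decide

/-- `R¹` kills `D_{p,z}`. [folklore] -/
private theorem R1_koD_P (h : Nat.Coprime 18 p) [NeZero (18 * p)] (hp : p.Prime)
    (ez : ZMod 18) (bz : ZMod p) (c : ZMod p) : R1 h (koD (18 * p) p (pt h ez bz)) c = 0 := by
  simp only [R1, hat_koD_P h hp]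
  fin_cases ez <;> simp +decide

/-- `R¹` kills `D_{2p,z}`. [folklore] -/
private theorem R1_koD_2P (h : Nat.Coprime 18 p) [NeZero (18 * p)] (hp : p.Prime)
    (ez : ZMod 18) (bz : ZMod p) (c : ZMod p) : R1 h (koD (18 * p) (2 * p) (pt h ez bz)) c = 0 := by
  simp only [R1, hat_koD_mulP h hp (k := 2) (j := 9) (by norm_num)]
  fin_cases ez <;> simp +decide

/-- `R¹` kills `D_{3p,z}`. [folklore] -/
private theorem R1_koD_3P (h : Nat.Coprime 18 p) [NeZero (18 * p)] (hp : p.Prime)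
    (ez : ZMod 18) (bz : ZMod p) (c : ZMod p) : R1 h (koD (18 * p) (3 * p) (pt h ez bz)) c = 0 := by
  simp only [R1, hat_koD_mulP h hp (k := 3) (j := 6) (by norm_num)]
  fin_cases ez <;> simp +decide <;> ring

/-- `R¹` kills `D_{6p,z}`. [folklore] -/
private theorem R1_koD_6P (h : Nat.Coprime 18 p) [NeZero (18 * p)] (hp : p.Prime)
    (ez : ZMod 18) (bz : ZMod p) (c : ZMod p) : R1 h (koD (18 * p) (6 * p) (pt h ez bz)) c = 0 := by
  simp only [R1, hat_koD_mulP h hp (k := 6) (j := 3) (by norm_num)]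
  fin_cases ez <;> simp +decide <;> ring

/-- `R¹` kills `D_{9p,z}`. [folklore] -/
private theorem R1_koD_9P (h : Nat.Coprime 18 p) [NeZero (18 * p)] (hp : p.Prime) (h5 : 5 ≤ p)
    (ez : ZMod 18) (bz : ZMod p) (c : ZMod p) : R1 h (koD (18 * p) (9 * p) (pt h ez bz)) c = 0 := by
  obtain ⟨c2, c2'⟩ := cancel_two hp h5 c bz
  simp only [R1, hat_koD_mulP h hp (k := 9) (j := 2) (by norm_num)]
  fin_cases ez <;> simp +decide [c2, c2'] <;> ring

/-- **`R¹` kills every distribution vector.** [folklore] -/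
private theorem R1_koD (h : Nat.Coprime 18 p) [NeZero (18 * p)] (hp : p.Prime) (h5 : 5 ≤ p) {M : ℕ}
    (hM : M ∈ (18 * p).divisors) (z : ZMod (18 * p)) {c : ZMod p} (hc : c ≠ 0) : R1 h (koD (18 * p) M z) c = 0 := by
  obtain ⟨ez, bz, rfl⟩ : ∃ ez bz, z = pt h ez bz := ⟨_, _, (pt_crt h z).symm⟩
  rcases eq_of_dvd_eighteen_mul_prime hp h5 (Nat.dvd_of_mem_divisors hM) with
    rfl | rfl | rfl | rfl | rfl | rfl | rfl | rfl | rfl | rfl | rfl | hM18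
  · exact R1_koD_1 h hp h5 ez bz hc
  · exact R1_koD_2 h hp h5 ez bz hc
  · exact R1_koD_3 h hp h5 ez bz hc
  · exact R1_koD_6 h hp h5 ez bz hc
  · exact R1_koD_9 h hp h5 ez bz hc
  · exact R1_koD_18 h hp h5 ez bz hc
  · exact R1_koD_P h hp ez bz c
  · exact R1_koD_2P h hp ez bz c
  · exact R1_koD_3P h hp ez bz c
  · exact R1_koD_6P h hp ez bz c
  · exact R1_koD_9P h hp h5 ez bz c
  · rw [hM18]
    simp only [R1, hat, koD_top, sub_self]
    norm_num

/-- `R²` kills `D_{1,z}`. [folklore] -/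
private theorem R2_koD_1 (h : Nat.Coprime 18 p) [NeZero (18 * p)] (hp : p.Prime) (h5 : 5 ≤ p)
    (ez : ZMod 18) (bz : ZMod p) {c : ZMod p} (hc : c ≠ 0) : R2 h (koD (18 * p) 1 (pt h ez bz)) c = 0 := by
  have hc2 := two_mul_ne_zero' hp h5 hc
  simp only [R2, hat_koD_dvd_eighteen h (by norm_num : 1 ∣ 18) (by norm_num) _ _ hc,
    hat_koD_dvd_eighteen h (by norm_num : 1 ∣ 18) (by norm_num) _ _ hc2]
  fin_cases ez <;> simp +decide

/-- `R²` kills `D_{2,z}`. [folklore] -/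
private theorem R2_koD_2 (h : Nat.Coprime 18 p) [NeZero (18 * p)] (hp : p.Prime) (h5 : 5 ≤ p)
    (ez : ZMod 18) (bz : ZMod p) {c : ZMod p} (hc : c ≠ 0) : R2 h (koD (18 * p) 2 (pt h ez bz)) c = 0 := by
  have hc2 := two_mul_ne_zero' hp h5 hc
  simp only [R2, hat_koD_dvd_eighteen h (by norm_num : 2 ∣ 18) (by norm_num) _ _ hc,
    hat_koD_dvd_eighteen h (by norm_num : 2 ∣ 18) (by norm_num) _ _ hc2]
  fin_cases ez <;> simp +decide

/-- `R²` kills `D_{3,z}`. [folklore] -/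
private theorem R2_koD_3 (h : Nat.Coprime 18 p) [NeZero (18 * p)] (hp : p.Prime) (h5 : 5 ≤ p)
    (ez : ZMod 18) (bz : ZMod p) {c : ZMod p} (hc : c ≠ 0) : R2 h (koD (18 * p) 3 (pt h ez bz)) c = 0 := by
  have hc2 := two_mul_ne_zero' hp h5 hc
  simp only [R2, hat_koD_dvd_eighteen h (by norm_num : 3 ∣ 18) (by norm_num) _ _ hc,
    hat_koD_dvd_eighteen h (by norm_num : 3 ∣ 18) (by norm_num) _ _ hc2]
  fin_cases ez <;> simp +decide

/-- `R²` kills `D_{6,z}`. [folklore] -/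
private theorem R2_koD_6 (h : Nat.Coprime 18 p) [NeZero (18 * p)] (hp : p.Prime) (h5 : 5 ≤ p)
    (ez : ZMod 18) (bz : ZMod p) {c : ZMod p} (hc : c ≠ 0) : R2 h (koD (18 * p) 6 (pt h ez bz)) c = 0 := by
  have hc2 := two_mul_ne_zero' hp h5 hc
  simp only [R2, hat_koD_dvd_eighteen h (by norm_num : 6 ∣ 18) (by norm_num) _ _ hc,
    hat_koD_dvd_eighteen h (by norm_num : 6 ∣ 18) (by norm_num) _ _ hc2]
  fin_cases ez <;> simp +decide

/-- `R²` kills `D_{9,z}`. [folklore] -/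
private theorem R2_koD_9 (h : Nat.Coprime 18 p) [NeZero (18 * p)] (hp : p.Prime) (h5 : 5 ≤ p)
    (ez : ZMod 18) (bz : ZMod p) {c : ZMod p} (hc : c ≠ 0) : R2 h (koD (18 * p) 9 (pt h ez bz)) c = 0 := by
  have hc2 := two_mul_ne_zero' hp h5 hc
  simp only [R2, hat_koD_dvd_eighteen h (by norm_num : 9 ∣ 18) (by norm_num) _ _ hc,
    hat_koD_dvd_eighteen h (by norm_num : 9 ∣ 18) (by norm_num) _ _ hc2]
  fin_cases ez <;> simp +decide

/-- `R²` kills `D_{18,z}`. [folklore] -/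
private theorem R2_koD_18 (h : Nat.Coprime 18 p) [NeZero (18 * p)] (hp : p.Prime) (h5 : 5 ≤ p)
    (ez : ZMod 18) (bz : ZMod p) {c : ZMod p} (hc : c ≠ 0) : R2 h (koD (18 * p) 18 (pt h ez bz)) c = 0 := by
  have hc2 := two_mul_ne_zero' hp h5 hc
  simp only [R2, hat_koD_dvd_eighteen h (by norm_num : 18 ∣ 18) (by norm_num) _ _ hc,
    hat_koD_dvd_eighteen h (by norm_num : 18 ∣ 18) (by norm_num) _ _ hc2]
  fin_cases ez <;> simp +decide

/-- `R²` kills `D_{p,z}`. [folklore] -/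
private theorem R2_koD_P (h : Nat.Coprime 18 p) [NeZero (18 * p)] (hp : p.Prime)
    (ez : ZMod 18) (bz : ZMod p) (c : ZMod p) : R2 h (koD (18 * p) p (pt h ez bz)) c = 0 := by
  simp only [R2, hat_koD_P h hp]
  fin_cases ez <;> simp +decide

/-- `R²` kills `D_{2p,z}`. [folklore] -/
private theorem R2_koD_2P (h : Nat.Coprime 18 p) [NeZero (18 * p)] (hp : p.Prime)
    (ez : ZMod 18) (bz : ZMod p) (c : ZMod p) : R2 h (koD (18 * p) (2 * p) (pt h ez bz)) c = 0 := by
  simp only [R2, hat_koD_mulP h hp (k := 2) (j := 9) (by norm_num)]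
  fin_cases ez <;> simp +decide

/-- `R²` kills `D_{3p,z}`. [folklore] -/
private theorem R2_koD_3P (h : Nat.Coprime 18 p) [NeZero (18 * p)] (hp : p.Prime)
    (ez : ZMod 18) (bz : ZMod p) (c : ZMod p) : R2 h (koD (18 * p) (3 * p) (pt h ez bz)) c = 0 := by
  simp only [R2, hat_koD_mulP h hp (k := 3) (j := 6) (by norm_num)]
  fin_cases ez <;> simp +decide <;> ring

/-- `R²` kills `D_{6p,z}`. [folklore] -/
private theorem R2_koD_6P (h : Nat.Coprime 18 p) [NeZero (18 * p)] (hp : p.Prime)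
    (ez : ZMod 18) (bz : ZMod p) (c : ZMod p) : R2 h (koD (18 * p) (6 * p) (pt h ez bz)) c = 0 := by
  simp only [R2, hat_koD_mulP h hp (k := 6) (j := 3) (by norm_num)]
  fin_cases ez <;> simp +decide <;> ring

/-- `R²` kills `D_{9p,z}`. [folklore] -/
private theorem R2_koD_9P (h : Nat.Coprime 18 p) [NeZero (18 * p)] (hp : p.Prime) (h5 : 5 ≤ p)
    (ez : ZMod 18) (bz : ZMod p) (c : ZMod p) : R2 h (koD (18 * p) (9 * p) (pt h ez bz)) c = 0 := by
  obtain ⟨c2, c2'⟩ := cancel_two hp h5 c bz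
  simp only [R2, hat_koD_mulP h hp (k := 9) (j := 2) (by norm_num)]
  fin_cases ez <;> simp +decide [c2, c2'] <;> ring

/-- **`R²` kills every distribution vector.** [folklore] -/
private theorem R2_koD (h : Nat.Coprime 18 p) [NeZero (18 * p)] (hp : p.Prime) (h5 : 5 ≤ p) {M : ℕ}
    (hM : M ∈ (18 * p).divisors) (z : ZMod (18 * p)) {c : ZMod p} (hc : c ≠ 0) : R2 h (koD (18 * p) M z) c = 0 := by
  obtain ⟨ez, bz, rfl⟩ : ∃ ez bz, z = pt h ez bz := ⟨_, _, (pt_crt h z).symm⟩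
  rcases eq_of_dvd_eighteen_mul_prime hp h5 (Nat.dvd_of_mem_divisors hM) with
    rfl | rfl | rfl | rfl | rfl | rfl | rfl | rfl | rfl | rfl | rfl | hM18
  · exact R2_koD_1 h hp h5 ez bz hc
  · exact R2_koD_2 h hp h5 ez bz hc
  · exact R2_koD_3 h hp h5 ez bz hc
  · exact R2_koD_6 h hp h5 ez bz hc
  · exact R2_koD_9 h hp h5 ez bz hc
  · exact R2_koD_18 h hp h5 ez bz hc
  · exact R2_koD_P h hp ez bz c
  · exact R2_koD_2P h hp ez bz c
  · exact R2_koD_3P h hp ez bz c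
  · exact R2_koD_6P h hp ez bz c
  · exact R2_koD_9P h hp h5 ez bz c
  · rw [hM18]
    simp only [R2, hat, koD_top, sub_self]
    norm_num

/-! ### The two relations on Hodge multisets of level `18p` -/

/-- **Koblitz–Ogus, functional form:** a linear functional on `ℚ^{ℤ/18p}` that kills the negation-invariant functions and all
distribution vectors kills the multiplicity function of every Hodge multiset (the tree's PROVED
`KoblitzOgus.hodge_eq_combination`; as in `HodgeQuadruplesSixPrime`, `HodgeQuadruplesTwelvePrime`). [cite: Deligne1982HodgeCycles, Rem. 7.16 (a)] -/
private theorem functional_count_eq_zero [NeZero (18 * p)] {s : Multiset (ZMod (18 * p))} (hs : IsHodgeMultiset s)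
    (L : (ZMod (18 * p) → ℚ) → ℚ)
    (hadd : ∀ g g' : ZMod (18 * p) → ℚ, L (fun z ↦ g z + g' z) = L g + L g')
    (hmul : ∀ (a : ℚ) (g : ZMod (18 * p) → ℚ), L (fun z ↦ a * g z) = a * L g)
    (hsum : ∀ {ι : Type} (t : Finset ι) (g : ι → ZMod (18 * p) → ℚ), L (fun z ↦ ∑ i ∈ t, g i z) = ∑ i ∈ t, L (g i))
    (heven : ∀ g : ZMod (18 * p) → ℚ, (∀ z, g (-z) = g z) → L g = 0)
    (hko : ∀ M ∈ (18 * p).divisors, ∀ y : ZMod (18 * p), L (koD (18 * p) M y) = 0) :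
    L (fun w ↦ (count w s : ℚ)) = 0 := by
  classical
  obtain ⟨cr, cd, hrep⟩ := Literature.NumberTheory.Transcendental.KoblitzOgus.hodge_eq_combination
    (N := 18 * p) (fun x ↦ (count x s : ℚ)) (fun u hu ↦ hs.sum_count_mul_bern_eq_zero hu)
  have hf : (fun w ↦ (count w s : ℚ)) =
      fun w ↦ (∑ a : ZMod (18 * p), cr a * ((if a = w then (1 : ℚ) else 0) + (if -a = w then 1 else 0))) +
        ∑ M ∈ (18 * p).divisors, ∑ y : ZMod (18 * p), cd M y * koD (18 * p) M y w := funext hrep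
  rw [hf, hadd, hsum, hsum]
  have hA : ∀ a : ZMod (18 * p),
      L (fun w ↦ cr a * ((if a = w then (1 : ℚ) else 0) + (if -a = w then 1 else 0))) = 0 := fun a ↦ by
    rw [hmul, heven _ fun w ↦ ?_, mul_zero]
    rw [add_comm]
    congr 1
    · simp only [neg_inj]
    · simp only [eq_neg_iff_add_eq_zero, neg_eq_iff_add_eq_zero]
  have hB : ∀ M ∈ (18 * p).divisors, L (fun w ↦ ∑ y : ZMod (18 * p), cd M y * koD (18 * p) M y w) = 0 :=
    fun M hM ↦ by
      rw [hsum]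
      refine Finset.sum_eq_zero fun y _ ↦ ?_
      rw [hmul, hko M hM y, mul_zero]
  rw [Finset.sum_eq_zero fun a _ ↦ hA a, Finset.sum_eq_zero hB, add_zero]

/-- `R¹` kills the multiplicity function of every Hodge multiset. [cite: Deligne1982HodgeCycles, Rem. 7.16 (a)] -/
private theorem R1_count_eq_zero (h : Nat.Coprime 18 p) [NeZero (18 * p)] (hp : p.Prime) (h5 : 5 ≤ p)
    {s : Multiset (ZMod (18 * p))} (hs : IsHodgeMultiset s) {c : ZMod p} (hc : c ≠ 0) :
    R1 h (fun w ↦ (count w s : ℚ)) c = 0 := by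
  have lin := R1_linear h c
  exact functional_count_eq_zero hs (fun g ↦ R1 h g c) lin.1 lin.2.1 (fun t g ↦ lin.2.2.1 t g) lin.2.2.2
    (fun M hM y ↦ R1_koD h hp h5 hM y hc)

/-- `R²` kills the multiplicity function of every Hodge multiset. [cite: Deligne1982HodgeCycles, Rem. 7.16 (a)] -/
private theorem R2_count_eq_zero (h : Nat.Coprime 18 p) [NeZero (18 * p)] (hp : p.Prime) (h5 : 5 ≤ p)
    {s : Multiset (ZMod (18 * p))} (hs : IsHodgeMultiset s) {c : ZMod p} (hc : c ≠ 0) :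
    R2 h (fun w ↦ (count w s : ℚ)) c = 0 := by
  have lin := R2_linear h c
  exact functional_count_eq_zero hs (fun g ↦ R2 h g c) lin.1 lin.2.1 (fun t g ↦ lin.2.2.1 t g) lin.2.2.2
    (fun M hM y ↦ R2_koD h hp h5 hM y hc)

/-! ### Public statements -/

/-- The residue of `ℤ/18p` with Chinese-remainder coordinates `(u, c) ∈ ℤ/18 × ℤ/p` (plumbing for the statements below). [folklore] -/
def crtPt (h : Nat.Coprime 18 p) (u : ZMod 18) (c : ZMod p) : ZMod (18 * p) := (ZMod.chineseRemainder h).symm (u, c)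

/-- `crtPt` is the private `pt`. [folklore] -/
private theorem crtPt_eq (h : Nat.Coprime 18 p) (u : ZMod 18) (c : ZMod p) : crtPt h u c = pt h u c := rfl

/-- The odd part of the multiplicity function of `s`: `ô(w) = #_w(s) − #_{−w}(s)` (an integer). [folklore] -/
def oddCount (s : Multiset (ZMod (18 * p))) (w : ZMod (18 * p)) : ℤ := (count w s : ℤ) - count (-w) s

/-- `ĝ` of the multiplicity function is `oddCount`, cast to `ℚ`. [folklore] -/
private theorem hat_count_eq (s : Multiset (ZMod (18 * p))) (w : ZMod (18 * p)) :
    hat (fun w ↦ (count w s : ℚ)) w = (oddCount s w : ℚ) := by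
  simp only [hat, oddCount, Int.cast_sub, Int.cast_natCast]

/-- **First Koblitz–Ogus relation at level `18p`.** For every Hodge multiset `s` of level `18p`, `p ≥ 5` prime, and every
`c ≢ 0 (mod p)`, with `ô(u, c) = #_{(u,c)}(s) − #_{(−u,−c)}(s)` in the coordinates `ℤ/18p ≅ ℤ/18 × ℤ/p`:
`−ô(5,c) + ô(7,c) + ô(11,c) − ô(13,c) + ô(1,2c) + ô(4,2c) − ô(5,2c) − ô(8,2c) − ô(10,2c) − ô(13,2c) + ô(14,2c) + ô(17,2c) = 0` — a
consequence of the Koblitz–Ogus theorem (the multiplicity function is a combination of reflection and distribution vectors, all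
of which this odd functional annihilates). [cite: Deligne1982HodgeCycles, Rem. 7.16 (a)] [cite: Aoki1983, Prop. 2.2]
[cite: Shioda1982PicardFermat, §3 p. 727] -/
theorem relOne_eighteenPrime [NeZero (18 * p)] (hp : p.Prime) (h5 : 5 ≤ p) (h : Nat.Coprime 18 p)
    {s : Multiset (ZMod (18 * p))} (hs : IsHodgeMultiset s) {c : ZMod p} (hc : c ≠ 0) :
    -oddCount s (crtPt h 5 c) + oddCount s (crtPt h 7 c) + oddCount s (crtPt h 11 c) - oddCount s (crtPt h 13 c) +
      oddCount s (crtPt h 1 (2 * c)) + oddCount s (crtPt h 4 (2 * c)) - oddCount s (crtPt h 5 (2 * c)) -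
      oddCount s (crtPt h 8 (2 * c)) - oddCount s (crtPt h 10 (2 * c)) - oddCount s (crtPt h 13 (2 * c)) +
      oddCount s (crtPt h 14 (2 * c)) + oddCount s (crtPt h 17 (2 * c)) = 0 := by
  have key := R1_count_eq_zero h hp h5 hs hc
  simp only [R1, hat_count_eq, ← crtPt_eq] at key
  exact_mod_cast key

/-- **Second Koblitz–Ogus relation at level `18p`.** For every Hodge multiset `s` of level `18p`, `p ≥ 5` prime, and every
`c ≢ 0 (mod p)`: `ô(1,c) − ô(5,c) − ô(13,c) + ô(17,c) + ô(1,2c) + ô(2,2c) − ô(7,2c) − ô(8,2c) − ô(10,2c) − ô(11,2c) + ô(16,2c) + ô(17,2c)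
= 0`. [cite: Deligne1982HodgeCycles, Rem. 7.16 (a)] [cite: Aoki1983, Prop. 2.2] [cite: Shioda1982PicardFermat, §3 p. 727] -/
theorem relTwo_eighteenPrime [NeZero (18 * p)] (hp : p.Prime) (h5 : 5 ≤ p) (h : Nat.Coprime 18 p)
    {s : Multiset (ZMod (18 * p))} (hs : IsHodgeMultiset s) {c : ZMod p} (hc : c ≠ 0) :
    oddCount s (crtPt h 1 c) - oddCount s (crtPt h 5 c) - oddCount s (crtPt h 13 c) + oddCount s (crtPt h 17 c) +
      oddCount s (crtPt h 1 (2 * c)) + oddCount s (crtPt h 2 (2 * c)) - oddCount s (crtPt h 7 (2 * c)) -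
      oddCount s (crtPt h 8 (2 * c)) - oddCount s (crtPt h 10 (2 * c)) - oddCount s (crtPt h 11 (2 * c)) +
      oddCount s (crtPt h 16 (2 * c)) + oddCount s (crtPt h 17 (2 * c)) = 0 := by
  have key := R2_count_eq_zero h hp h5 hs hc
  simp only [R2, hat_count_eq, ← crtPt_eq] at key
  exact_mod_cast key

end EighteenPrime

end Literature.AlgebraicGeometry.Shioda1982
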